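import Summits.QuantumFields.BalabanUV.Beta.SymRootedAveragingReflection
import Summits.QuantumFields.BalabanUV.Beta.RootedJetReflection

/-!
# `BalabanUV.Beta.SymRootedJetReflection` — the μ ≠ α ∕ μ = α REFLECTION LAWS of the (0.4)-SYMMETRISED rooted averaged jet
# `symQjetAt` on the LEFT CHART WITH GENERAL BACKGROUND (β sub-cell, row D1, TABLES-SYM-LEAN S2c, INTERFACE-LEVEL twin «M2bσ» of
# an3's `RootedJetReflection`; an1 gen 43, option (C) of S2C-SCOPE-v1: name substitution over an1's averaging-specific layer)

HONEST FRAMING (cell charter, verbatim): «discharging BetaPertH makes Bałaban's UV stability UNCONDITIONAL — a real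
constructive-QFT result; it is NOT the continuum limit and NOT the Clay problem.»  HONEST DEPENDENCY (verbatim): «continuum YM on
T⁴ ⇐ BetaPertH ∧ nine spine estimates (0/9 proved); BetaPertH ⇐ (D1) ∧ (D4) ∧ CAP+tail; G-an2-4 gates asym, D1 and NE2/3/4.»
ABSOLUTE RULE (R-g25-7 ∕ R-D1-g30-1 (A)): the (0.4)-symmetrised averaging is the exp of the MEAN OF LOGS over the pair family
`{loop^{σ,σ′}}`; every object below is node 12's chart algebra read on an1's `symPhiGAt` (S2b part 1) instead of the comb `PhiGAt`.
DERIVED cell leaf: [folklore] ring algebra.  The chart letters `GfL`∕`GbL`, the reflected chart data `omegaR`, `reflPair_Gf_Gb`,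
`reflPair_Gb_Gf` and the Lie-level identity `logT_invT_mul_invT_invT` are FAMILY-INDEPENDENT and imported BY NAME from
`RootedJetReflection`; the two averaging-specific inputs are an1's `symPhiGAt_sref_of_ne` and `symPhiGAt_reflPair_self_eq_invT`
(`SymRootedAveragingReflection`) and `aug_symPhiGAt_eq_one` (`SymRootedJetDictionary`).  No statement of Bałaban's papers is
typed here, no `[cite:]` tag, no `Prop` is minted, no binder of the β-function wall (`hW`/`hR`/`D1Tel`/`D1Rep`, (D1), `BetaPertH`)
is instantiated or discharged.  NOT summit progress.

## What this module proves (sym twin of `RootedJetReflection` §1, §3, §4 — statement for statement, `PhiXAt ↦ symPhiXAt`)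

* §1 `symPhiLAt`, `symQjetLAt` := the symmetrised rooted averaging ∕ jet on the left chart `(GfL ω E, GbL ω Ē)`; bridges
  `symPhiRAt_eq_symPhiLAt`, `symQjetAt_eq_symQjetLAt` (`rfl`); `kσ_symPhiLAt`, `snd_symPhiLAt_zero`, `snd_invT_symPhiLAt_zero`,
  `snd_symPhiRAt_zero`, `snd_invT_symPhiRAt_zero`.
* §3 μ ≠ α: `symQjetAt 𝕜 (ctr d L) ω B B′ L μ (sref α y) = symQjetLAt 𝕜 (ctr d L) (omegaR α ω B B′) E♯ Ē♯ L μ y`.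
* §4 μ = α: `symPhiLAt (ctr d L) ω♯ E♯ Ē♯ L α y = invT (symPhiRAt (ctr d L) ω B B′ L α (bref α α y))`, `P · P₀ = 1 = P₀ · P`,
  `symQjetLAt … L α y = −(P₀ · symQjetAt … L α y′ · P)` and `symQjetAt … L α y′ = −(P · symQjetLAt … L α y · P₀)`.

## What is NOT here
No `ω`-linearity, no `Ad`-expansion, no BCH, no table; nothing about `symMixFFAt`/`symVh₂SAt`/(T2-B)/(T2-M₂) is proved in this file.
-/

namespace Summit.QuantumFields.BalabanUV.Beta.SymRootedJetReflection

open Finset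
open scoped BigOperators
open Literature.MathematicalPhysics.QuantumFieldTheory.Balaban1983to89
open Literature.MathematicalPhysics.QuantumFieldTheory.Balaban1983to89.Beta
open AffineAveraging (Form1 box)
open AveragingContoursRooted (ctr)
open AveragingThirdJet (Tau Rho dmk fst_dmk snd_dmk dfst_mul dsnd_mul Ebg Ebi Gf Gb fst_Gf snd_Gf fst_Gb snd_Gb Gf_mul_Gb Gb_mul_Gf
  Ebg_mul_Ebi Ebi_mul_Ebg c00_Ebg c00_Ebi augR augR_apply expT logT invT map_invT)
open AveragingThirdJet.Tau (c00)
open AveragingMixedJetTables (kσ kσ_apply)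
open ResolventReflection (sref bref)
open Summit.QuantumFields.BalabanUV.Beta.SymAveragingMixedJetTables (symPhiGAt map_symPhiGAt symPhiRAt symQjetAt)
open Summit.QuantumFields.BalabanUV.Beta.SymRootedJetDictionary (aug_symPhiGAt_eq_one)
open Summit.QuantumFields.BalabanUV.Beta.SymRootedAveragingReflection (symPhiGAt_sref_of_ne symPhiGAt_reflPair_self_eq_invT)
open Summit.QuantumFields.BalabanUV.Beta.RootedHolonomyReflection (R1g R1g_of_ne)
open Summit.QuantumFields.BalabanUV.Beta.RootedHolonomyReflectionHol (reflPair reflPair_of_ne reflPair_self)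
open Summit.QuantumFields.BalabanUV.Beta.TruncatedNil4Calculus (mul_invT_eq_one invT_mul_eq_one aug_invT_eq_one invT_invT
  invT_mul_rev logT_invT nil4_augR)
open Summit.QuantumFields.BalabanUV.Beta.RootedJetReflection (GfL GbL fst_GfL snd_GfL fst_GbL snd_GbL GbL_mul_GfL GfL_mul_GbL
  augR_GfL augR_GbL kσ_GfL kσ_GbL omegaR omegaR_of_ne omegaR_self omegaR_zero reflPair_Gf_Gb reflPair_Gb_Gf logT_invT_mul_invT_invT)

/-! ## §1 The symmetrised averaging on the left chart with general background -/

section Chart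

variable (𝕜 : Type*) [Field 𝕜] {d : ℕ} {𝔸 : Type*} [Ring 𝔸] [Algebra 𝕜 𝔸]

/-- [our object] The (0.4)-symmetrised rooted one-step averaging on the left chart with general background (sym twin of `PhiLAt`). -/
noncomputable def symPhiLAt (ρ : Fin d → ℤ) (ω E Eb : Form1 d (Tau 𝔸)) (L : ℕ) (μ : Fin d) (y : Fin d → ℤ) : Rho 𝔸 :=
  symPhiGAt 𝕜 ρ (GfL ω E) (GbL ω Eb) L μ y

/-- [our object] The (0.4)-symmetrised rooted averaged jet on the left chart with general background (sym twin of `QjetLAt`): the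
`ρ`-coefficient of `logT (symΦ^ρ(ω̂; E, Ē) · invT (symΦ^ρ(0; E, Ē)))`. -/
noncomputable def symQjetLAt (ρ : Fin d → ℤ) (ω E Eb : Form1 d (Tau 𝔸)) (L : ℕ) (μ : Fin d) (y : Fin d → ℤ) : Tau 𝔸 :=
  (logT 𝕜 (symPhiLAt 𝕜 ρ ω E Eb L μ y * invT (symPhiLAt 𝕜 ρ 0 E Eb L μ y))).snd

variable {𝕜}

/-- [folklore] BRIDGE: `symPhiRAt ρ ω B B′ = symPhiLAt ρ ω (Ebg B B′) (Ebi B B′)` (`rfl`). -/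
theorem symPhiRAt_eq_symPhiLAt (ρ : Fin d → ℤ) (ω : Form1 d (Tau 𝔸)) (B B' : Form1 d 𝔸) (L : ℕ) (μ : Fin d) (y : Fin d → ℤ) :
    symPhiRAt 𝕜 ρ ω B B' L μ y = symPhiLAt 𝕜 ρ ω (Ebg B B') (Ebi B B') L μ y := rfl

/-- [folklore] BRIDGE: `symQjetAt ρ ω B B′ = symQjetLAt ρ ω (Ebg B B′) (Ebi B B′)` (`rfl`). -/
theorem symQjetAt_eq_symQjetLAt (ρ : Fin d → ℤ) (ω : Form1 d (Tau 𝔸)) (B B' : Form1 d 𝔸) (L : ℕ) (μ : Fin d) (y : Fin d → ℤ) :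
    symQjetAt 𝕜 ρ ω B B' L μ y = symQjetLAt 𝕜 ρ ω (Ebg B B') (Ebi B B') L μ y := rfl

/-- [folklore] Killing `σ` on the symmetrised left-chart averaging kills the fluctuation letter. -/
theorem kσ_symPhiLAt (ρ : Fin d → ℤ) (ω E Eb : Form1 d (Tau 𝔸)) (L : ℕ) (μ : Fin d) (y : Fin d → ℤ) :
    kσ 𝕜 (symPhiLAt 𝕜 ρ ω E Eb L μ y) = symPhiLAt 𝕜 ρ 0 E Eb L μ y := by
  rw [symPhiLAt, symPhiLAt, map_symPhiGAt]; simp only [kσ_GfL, kσ_GbL]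

/-- [folklore] The fluctuation-free symmetrised averaging has no `ρ`-component. -/
theorem snd_symPhiLAt_zero (ρ : Fin d → ℤ) (E Eb : Form1 d (Tau 𝔸)) (L : ℕ) (μ : Fin d) (y : Fin d → ℤ) :
    (symPhiLAt 𝕜 ρ 0 E Eb L μ y).snd = 0 := by
  have h := congrArg TrivSqZeroExt.snd (kσ_symPhiLAt (𝕜 := 𝕜) ρ 0 E Eb L μ y)
  rw [kσ_apply, snd_dmk] at h
  exact h.symm

/-- [folklore] … nor has its truncated inverse. -/
theorem snd_invT_symPhiLAt_zero (ρ : Fin d → ℤ) (E Eb : Form1 d (Tau 𝔸)) (L : ℕ) (μ : Fin d) (y : Fin d → ℤ) :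
    (invT (symPhiLAt 𝕜 ρ 0 E Eb L μ y)).snd = 0 := by
  have h := congrArg TrivSqZeroExt.snd (map_invT (kσ 𝕜) (symPhiLAt 𝕜 ρ 0 E Eb L μ y))
  rw [kσ_symPhiLAt, kσ_apply, snd_dmk] at h
  exact h.symm

/-- [folklore] `(symPhiRAt ρ 0 B B′).snd = 0` (node 12's chart, by the bridge). -/
theorem snd_symPhiRAt_zero (ρ : Fin d → ℤ) (B B' : Form1 d 𝔸) (L : ℕ) (μ : Fin d) (y : Fin d → ℤ) :
    (symPhiRAt 𝕜 ρ 0 B B' L μ y).snd = 0 :=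
  snd_symPhiLAt_zero (𝕜 := 𝕜) ρ (Ebg B B') (Ebi B B') L μ y

/-- [folklore] `(invT (symPhiRAt ρ 0 B B′)).snd = 0`. -/
theorem snd_invT_symPhiRAt_zero (ρ : Fin d → ℤ) (B B' : Form1 d 𝔸) (L : ℕ) (μ : Fin d) (y : Fin d → ℤ) :
    (invT (symPhiRAt 𝕜 ρ 0 B B' L μ y)).snd = 0 :=
  snd_invT_symPhiLAt_zero (𝕜 := 𝕜) ρ (Ebg B B') (Ebi B B') L μ y

end Chart

/-! ## §3 The μ ≠ α law of the symmetrised rooted jet -/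

section Transverse

variable (𝕜 : Type*) [Field 𝕜] {d : ℕ} {𝔸 : Type*} [Ring 𝔸] [Algebra 𝕜 𝔸] {L : ℕ} (hL : Odd L)
include hL

/-- [folklore] μ ≠ α, averaging: `symPhiRAt (ctr d L) ω B B′ L μ (sref α y) = symPhiLAt (ctr d L) ω♯ E♯ Ē♯ L μ y` (an1's
`symPhiGAt_sref_of_ne` on the chart, read through the reflected chart data `reflPair_Gf_Gb`∕`reflPair_Gb_Gf`). -/
theorem symPhiRAt_sref_of_ne {α μ : Fin d} (h : μ ≠ α) (ω : Form1 d (Tau 𝔸)) (B B' : Form1 d 𝔸) (y : Fin d → ℤ) :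
    symPhiRAt 𝕜 (ctr d L) ω B B' L μ (sref α y)
      = symPhiLAt 𝕜 (ctr d L) (omegaR α ω B B') (reflPair α (Ebg B B') (Ebi B B')) (reflPair α (Ebi B B') (Ebg B B')) L μ y := by
  rw [symPhiRAt, symPhiGAt_sref_of_ne 𝕜 hL h, reflPair_Gf_Gb, reflPair_Gb_Gf, symPhiLAt]

/-- [folklore] **THE μ ≠ α LAW OF THE SYMMETRISED ROOTED JET**:
`symQjetAt (ctr d L) ω B B′ L μ (sref α y) = symQjetLAt (ctr d L) ω♯ E♯ Ē♯ L μ y`. -/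
theorem symQjetAt_sref_of_ne {α μ : Fin d} (h : μ ≠ α) (ω : Form1 d (Tau 𝔸)) (B B' : Form1 d 𝔸) (y : Fin d → ℤ) :
    symQjetAt 𝕜 (ctr d L) ω B B' L μ (sref α y)
      = symQjetLAt 𝕜 (ctr d L) (omegaR α ω B B') (reflPair α (Ebg B B') (Ebi B B')) (reflPair α (Ebi B B') (Ebg B B')) L μ y := by
  rw [symQjetAt, symQjetLAt, symPhiRAt_sref_of_ne 𝕜 hL h ω, symPhiRAt_sref_of_ne 𝕜 hL h 0, omegaR_zero]

end Transverse

/-! ## §4 The μ = α law of the symmetrised rooted jet -/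

section Longitudinal

variable (𝕜 : Type*) [Field 𝕜] {d : ℕ} {𝔸 : Type*} [Ring 𝔸] [Algebra 𝕜 𝔸] {L : ℕ} (hL : Odd L) (h2 : (2 : 𝕜) ≠ 0)
include hL h2

/-- [folklore] μ = α, averaging: `symPhiLAt (ctr d L) ω♯ E♯ Ē♯ L α y = invT (symPhiRAt (ctr d L) ω B B′ L α (bref α α y))` (an1's
`symPhiGAt_reflPair_self_eq_invT` on the chart: `augR ∘ Gf = 1`, `Gf · Gb = 1 = Gb · Gf`, `nil4_augR`). -/
theorem symPhiLAt_reflPair_self_eq_invT (α : Fin d) (ω : Form1 d (Tau 𝔸)) (B B' : Form1 d 𝔸) (y : Fin d → ℤ) :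
    symPhiLAt 𝕜 (ctr d L) (omegaR α ω B B') (reflPair α (Ebg B B') (Ebi B B')) (reflPair α (Ebi B B') (Ebg B B')) L α y
      = invT (symPhiRAt 𝕜 (ctr d L) ω B B' L α (bref α α y)) := by
  rw [symPhiLAt, ← reflPair_Gf_Gb, ← reflPair_Gb_Gf, symPhiRAt]
  exact symPhiGAt_reflPair_self_eq_invT hL (nil4_augR (𝕜 := 𝕜)) h2 (fun κ x => by simp) (fun κ x => by simp)
    (fun κ x => Gf_mul_Gb ω B B' κ x) (fun κ x => Gb_mul_Gf ω B B' κ x) α y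

/-- [folklore] … at `ω = 0`: `symPhiLAt (ctr d L) 0 E♯ Ē♯ L α y = invT (symPhiRAt (ctr d L) 0 B B′ L α (bref α α y))`. -/
theorem symPhiLAt_reflPair_zero_eq_invT (α : Fin d) (B B' : Form1 d 𝔸) (y : Fin d → ℤ) :
    symPhiLAt 𝕜 (ctr d L) 0 (reflPair α (Ebg B B') (Ebi B B')) (reflPair α (Ebi B B') (Ebg B B')) L α y
      = invT (symPhiRAt 𝕜 (ctr d L) 0 B B' L α (bref α α y)) := by
  have h := symPhiLAt_reflPair_self_eq_invT 𝕜 hL h2 α (0 : Form1 d (Tau 𝔸)) B B' y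
  rwa [omegaR_zero] at h

/-- [folklore] `P · P₀ = 1`: the backgrounds of the fluctuation-free symmetrised averaging at `(α, y′)` and of its reflection at `(α, y)`. -/
theorem fst_symPhiRAt_zero_mul_fst_symPhiLAt_zero (α : Fin d) (B B' : Form1 d 𝔸) (y : Fin d → ℤ) :
    (symPhiRAt 𝕜 (ctr d L) 0 B B' L α (bref α α y)).fst
      * (symPhiLAt 𝕜 (ctr d L) 0 (reflPair α (Ebg B B') (Ebi B B')) (reflPair α (Ebi B B') (Ebg B B')) L α y).fst = 1 := by
  have hΦ₀ : augR 𝕜 (symPhiRAt 𝕜 (ctr d L) 0 B B' L α (bref α α y)) = 1 :=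
    aug_symPhiGAt_eq_one (fun κ x => by simp) (fun κ x => by simp) (ctr d L) L α _
  rw [symPhiLAt_reflPair_zero_eq_invT 𝕜 hL h2, ← dfst_mul, mul_invT_eq_one (nil4_augR (𝕜 := 𝕜)) hΦ₀]
  rfl

/-- [folklore] `P₀ · P = 1`. -/
theorem fst_symPhiLAt_zero_mul_fst_symPhiRAt_zero (α : Fin d) (B B' : Form1 d 𝔸) (y : Fin d → ℤ) :
    (symPhiLAt 𝕜 (ctr d L) 0 (reflPair α (Ebg B B') (Ebi B B')) (reflPair α (Ebi B B') (Ebg B B')) L α y).fst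
      * (symPhiRAt 𝕜 (ctr d L) 0 B B' L α (bref α α y)).fst = 1 := by
  have hΦ₀ : augR 𝕜 (symPhiRAt 𝕜 (ctr d L) 0 B B' L α (bref α α y)) = 1 :=
    aug_symPhiGAt_eq_one (fun κ x => by simp) (fun κ x => by simp) (ctr d L) L α _
  rw [symPhiLAt_reflPair_zero_eq_invT 𝕜 hL h2, ← dfst_mul, invT_mul_eq_one (nil4_augR (𝕜 := 𝕜)) hΦ₀]
  rfl

/-- [folklore] **THE μ = α LAW OF THE SYMMETRISED ROOTED JET** (reflected side): with `y′ = bref α α y`,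
`P = (symΦ^{ρ_c}_{(α,y′)}(0; B, B′)).fst`, `P₀ = (symΦ^{ρ_c}_{(α,y)}(0; E♯, Ē♯)).fst`:
`symQjetLAt (ctr d L) ω♯ E♯ Ē♯ L α y = −(P₀ · symQjetAt (ctr d L) ω B B′ L α y′ · P)`. -/
theorem symQjetLAt_reflPair_self (α : Fin d) (ω : Form1 d (Tau 𝔸)) (B B' : Form1 d 𝔸) (y : Fin d → ℤ) :
    symQjetLAt 𝕜 (ctr d L) (omegaR α ω B B') (reflPair α (Ebg B B') (Ebi B B')) (reflPair α (Ebi B B') (Ebg B B')) L α y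
      = -((symPhiLAt 𝕜 (ctr d L) 0 (reflPair α (Ebg B B') (Ebi B B')) (reflPair α (Ebi B B') (Ebg B B')) L α y).fst
          * symQjetAt 𝕜 (ctr d L) ω B B' L α (bref α α y) * (symPhiRAt 𝕜 (ctr d L) 0 B B' L α (bref α α y)).fst) := by
  have hΦ : augR 𝕜 (symPhiRAt 𝕜 (ctr d L) ω B B' L α (bref α α y)) = 1 :=
    aug_symPhiGAt_eq_one (fun κ x => by simp) (fun κ x => by simp) (ctr d L) L α _
  have hΦ₀ : augR 𝕜 (symPhiRAt 𝕜 (ctr d L) 0 B B' L α (bref α α y)) = 1 :=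
    aug_symPhiGAt_eq_one (fun κ x => by simp) (fun κ x => by simp) (ctr d L) L α _
  rw [symQjetLAt, symQjetAt, symPhiLAt_reflPair_self_eq_invT 𝕜 hL h2, symPhiLAt_reflPair_zero_eq_invT 𝕜 hL h2,
    logT_invT_mul_invT_invT (nil4_augR (𝕜 := 𝕜)) h2 hΦ hΦ₀, TrivSqZeroExt.snd_neg, dsnd_mul, dsnd_mul, snd_invT_symPhiRAt_zero,
    snd_symPhiRAt_zero, zero_mul, add_zero, mul_zero, zero_add]

/-- [folklore] **THE μ = α LAW OF THE SYMMETRISED ROOTED JET** (original side): `symQjetAt (ctr d L) ω B B′ L α (bref α α y)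
= −(P · symQjetLAt (ctr d L) ω♯ E♯ Ē♯ L α y · P₀)`. -/
theorem symQjetAt_bref_self (α : Fin d) (ω : Form1 d (Tau 𝔸)) (B B' : Form1 d 𝔸) (y : Fin d → ℤ) :
    symQjetAt 𝕜 (ctr d L) ω B B' L α (bref α α y)
      = -((symPhiRAt 𝕜 (ctr d L) 0 B B' L α (bref α α y)).fst
          * symQjetLAt 𝕜 (ctr d L) (omegaR α ω B B') (reflPair α (Ebg B B') (Ebi B B')) (reflPair α (Ebi B B') (Ebg B B')) L α y
          * (symPhiLAt 𝕜 (ctr d L) 0 (reflPair α (Ebg B B') (Ebi B B')) (reflPair α (Ebi B B') (Ebg B B')) L α y).fst) := by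
  have hPP₀ := fst_symPhiRAt_zero_mul_fst_symPhiLAt_zero 𝕜 hL h2 α B B' y
  rw [symQjetLAt_reflPair_self 𝕜 hL h2]
  simp only [mul_neg, neg_mul, neg_neg, mul_assoc]
  rw [hPP₀, mul_one, ← mul_assoc, hPP₀, one_mul]

end Longitudinal

end Summit.QuantumFields.BalabanUV.Beta.SymRootedJetReflection
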